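import Summits.MatrixMultiplication.OmegaCensus.DominoZ5Z5Enumeration
import Summits.MatrixMultiplication.OmegaCensus.DominoZ5LineTable6
import Summits.MatrixMultiplication.OmegaCensus.DominoZ5LineTable7
import HarnessLib

/-!
# Normal-form enumeration on `ZMod 5 × ZMod 5`: multisets of size `6` and `7`

ω-census `pub-omega`, family (b3), seat pub-omega-group gen 19.  Framing: lottery ticket; floor = certified bounds/negative
ranges.  VALUE: the finite kernel computation behind the `ℤ₅ × ℤ₅` domino cell theorems with parts `6` and `7`
(`DominoZ5Z5Cells67.lean`); NOT progress on ω.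

Up to `GL₂(𝔽₅)` (applied to the quotient map, see `DominoZ5Z5Cells67.lean`) a multiset `F` of size `d ≥ 2` on `ℤ₅²` is in one
of three NORMAL FORMS: (i) `F(1,0) ≥ 1` and `F(0,1) ≥ 1`; (ii) `F(1,0) ≥ 1` and `F` vanishes off the axis `{u₂ = 0}`;
(iii) `F = d·[0]`.  In the numbering `pt i = (i/5, i%5)` of `DominoZ5Z5Enumeration.lean`: `(1,0) = pt 5`, `(0,1) = pt 1`, the
axis is `{i % 5 = 0}`.  The bounded enumerator `allVecsB` (per-index bounds; `allVecsB_spec`) runs the kit's check `chk` over the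
value lists of each normal form against the bit masks of `table6` / `table7` (`mask6_sound`, `mask7_sound`, proved from a
two-level packed kernel check).  One kernel `decide` handles ≈ 2·10⁴ value lists, so normal form (i) for `d = 7` (`118 755`
lists) is cut into nine boxes (`boxBounds`, prefixes `box7_1 … box7_9`, each ≤ `20 475` lists; `cover7a1 … cover7a9`) that are
reassembled semantically (`chk_of_nf1_seven`).  Result: `exists_table_entry_six`, `exists_table_entry_seven` — every value
function of sum `6` / `7` in normal form (stated inline) has a direction `j < 6` and a certified table entry whose count vector
is its line projection.  Numerical twin: `pub-omega-group-g19/code/cover2d.py` (20 602 / 118 966 normal-form lists, 0 uncovered).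
-/

namespace Summit.MatrixMultiplication.OmegaCensus

open Finset

namespace Z5Z5Domino

/-! ## The bounded enumerator -/

/-- Run `f` on every list `l` with `l.length = bs.length`, `l.sum = d` and `bs[i].1 ≤ l[i] ≤ bs[i].2`. [folklore] -/
def allVecsB : List (ℕ × ℕ) → ℕ → (List ℕ → Bool) → Bool
  | [], d, f => if d = 0 then f [] else true
  | b :: bs, d, f => (List.range (min b.2 d + 1 - b.1)).all fun c => allVecsB bs (d - (c + b.1)) fun l => f ((c + b.1) :: l)

/-- **Specification of the bounded enumerator.** [folklore] -/
theorem allVecsB_spec : ∀ (bs : List (ℕ × ℕ)) (d : ℕ) (f : List ℕ → Bool), allVecsB bs d f = true →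
    ∀ l : List ℕ, l.length = bs.length → l.sum = d →
      (∀ i < bs.length, (bs.getD i (0, 0)).1 ≤ l.getD i 0 ∧ l.getD i 0 ≤ (bs.getD i (0, 0)).2) → f l = true
  | [], d, f, h, l, hl, hs, _ => by
    have hl' : l = [] := List.eq_nil_of_length_eq_zero hl
    subst hl'
    simp only [List.sum_nil] at hs
    subst hs
    simpa [allVecsB] using h
  | b :: bs, d, f, h, l, hl, hs, hb => by
    obtain ⟨c, l', rfl⟩ := List.exists_cons_of_length_eq_add_one hl
    simp only [List.length_cons, Nat.add_right_cancel_iff] at hl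
    simp only [List.sum_cons] at hs
    simp only [allVecsB, List.all_eq_true, List.mem_range] at h
    have h0 := hb 0 (by simp)
    simp only [List.getD_cons_zero] at h0
    have hc : c - b.1 < min b.2 d + 1 - b.1 := by omega
    have h' := h (c - b.1) hc
    rw [show c - b.1 + b.1 = c by omega] at h'
    refine allVecsB_spec bs (d - c) (fun l => f (c :: l)) h' l' hl (by omega) fun i hi => ?_
    have := hb (i + 1) (by simp; omega)
    simpa using this

/-! ## Masks for parts `6` and `7` (two-level packed kernel checks) -/

/-- Mask of `table6` (base `7`). [folklore] -/
def mask6 : ℕ := mkMask 7 table6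

/-- Mask of `table7` (base `8`). [folklore] -/
def mask7 : ℕ := mkMask 8 table7

set_option maxHeartbeats 4000000 in
/-- Mask soundness for `table6`, packed form `k = 343a + b`. [folklore] -/
theorem mask6_sound_packed : ∀ a < 49, ∀ b < 343, mask6.testBit (343 * a + b) = true →
    ∃ e ∈ table6, e.1 = [(343 * a + b) / 2401, (343 * a + b) / 343 % 7, (343 * a + b) / 49 % 7,
      (343 * a + b) / 7 % 7, (343 * a + b) % 7] := by
  decide +kernel

set_option maxHeartbeats 4000000 in
/-- Mask soundness for `table7`, packed form `k = 512a + b`. [folklore] -/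
theorem mask7_sound_packed : ∀ a < 64, ∀ b < 512, mask7.testBit (512 * a + b) = true →
    ∃ e ∈ table7, e.1 = [(512 * a + b) / 4096, (512 * a + b) / 512 % 8, (512 * a + b) / 64 % 8,
      (512 * a + b) / 8 % 8, (512 * a + b) % 8] := by
  decide +kernel

/-- Mask soundness for `table6`, digit form. [folklore] -/
theorem mask6_sound : ∀ c₀ < 6 + 1, ∀ c₁ < 6 + 1, ∀ c₂ < 6 + 1, ∀ c₃ < 6 + 1, ∀ c₄ < 6 + 1,
    mask6.testBit (horner5 (6 + 1) c₀ c₁ c₂ c₃ c₄) = true → ∃ e ∈ table6, e.1 = [c₀, c₁, c₂, c₃, c₄] := by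
  intro c₀ h₀ c₁ h₁ c₂ h₂ c₃ h₃ c₄ h₄ hbit
  unfold horner5 at hbit
  set k := (((c₀ * (6 + 1) + c₁) * (6 + 1) + c₂) * (6 + 1) + c₃) * (6 + 1) + c₄ with hk
  rw [← Nat.div_add_mod k 343] at hbit
  obtain ⟨e, he, he1⟩ := mask6_sound_packed (k / 343) (by omega) (k % 343) (Nat.mod_lt _ (by omega)) hbit
  refine ⟨e, he, ?_⟩
  rw [he1, Nat.div_add_mod k 343]
  simp only [List.cons.injEq, and_true]
  omega

/-- Mask soundness for `table7`, digit form. [folklore] -/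
theorem mask7_sound : ∀ c₀ < 7 + 1, ∀ c₁ < 7 + 1, ∀ c₂ < 7 + 1, ∀ c₃ < 7 + 1, ∀ c₄ < 7 + 1,
    mask7.testBit (horner5 (7 + 1) c₀ c₁ c₂ c₃ c₄) = true → ∃ e ∈ table7, e.1 = [c₀, c₁, c₂, c₃, c₄] := by
  intro c₀ h₀ c₁ h₁ c₂ h₂ c₃ h₃ c₄ h₄ hbit
  unfold horner5 at hbit
  set k := (((c₀ * (7 + 1) + c₁) * (7 + 1) + c₂) * (7 + 1) + c₃) * (7 + 1) + c₄ with hk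
  rw [← Nat.div_add_mod k 512] at hbit
  obtain ⟨e, he, he1⟩ := mask7_sound_packed (k / 512) (by omega) (k % 512) (Nat.mod_lt _ (by omega)) hbit
  refine ⟨e, he, ?_⟩
  rw [he1, Nat.div_add_mod k 512]
  simp only [List.cons.injEq, and_true]
  omega

/-! ## Bounds lists and the kernel enumerations -/

/-- Bounds of normal form (i) with a prescribed prefix of per-index bounds (a "box"): outside the prefix, at least one point
at `pt 1` and `pt 5`, at most `d` anywhere. [folklore] -/
def boxBounds (d : ℕ) (pre : List (ℕ × ℕ)) : List (ℕ × ℕ) :=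
  (List.range 25).map fun i => pre.getD i (if i = 1 ∨ i = 5 then 1 else 0, d)

/-- Bounds (ii): at least one point at `pt 5`, support on the axis `{i % 5 = 0}`. [folklore] -/
def nfBounds2 (d : ℕ) : List (ℕ × ℕ) :=
  (List.range 25).map fun i => (if i = 5 then 1 else 0, if i % 5 = 0 then d else 0)

/-- Bounds (iii): everything at `pt 0`. [folklore] -/
def nfBounds3 (d : ℕ) : List (ℕ × ℕ) := (List.range 25).map fun i => (if i = 0 then d else 0, if i = 0 then d else 0)

/-- The nine boxes of normal form (i) for `d = 7` (prefix bounds on the first indices). [folklore] -/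
def box7 : ℕ → List (ℕ × ℕ)
  | 1 => [(1, 7)]
  | 2 => [(0, 0), (2, 7)]
  | 3 => [(0, 0), (1, 1), (1, 7)]
  | 4 => [(0, 0), (1, 1), (0, 0), (1, 7)]
  | 5 => [(0, 0), (1, 1), (0, 0), (0, 0), (1, 7)]
  | 6 => [(0, 0), (1, 1), (0, 0), (0, 0), (0, 0), (2, 7)]
  | 7 => [(0, 0), (1, 1), (0, 0), (0, 0), (0, 0), (1, 1), (1, 7)]
  | 8 => [(0, 0), (1, 1), (0, 0), (0, 0), (0, 0), (1, 1), (0, 0), (1, 7)]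
  | _ => [(0, 0), (1, 1), (0, 0), (0, 0), (0, 0), (1, 1), (0, 0), (0, 0)]

set_option maxHeartbeats 4000000 in
/-- Kernel enumeration, `d = 6`, normal form (i) (`20 475` lists). [folklore] -/
theorem cover6a : allVecsB (boxBounds 6 []) 6 (chk (6 + 1) mask6) = true := by decide +kernel

set_option maxHeartbeats 4000000 in
/-- Kernel enumeration, `d = 6`, normal form (ii). [folklore] -/
theorem cover6b : allVecsB (nfBounds2 6) 6 (chk (6 + 1) mask6) = true := by decide +kernel

/-- Kernel enumeration, `d = 6`, normal form (iii). [folklore] -/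
theorem cover6c : allVecsB (nfBounds3 6) 6 (chk (6 + 1) mask6) = true := by decide +kernel

set_option maxHeartbeats 4000000 in
/-- Kernel enumeration, `d = 7`, box 1 (`20 475` lists). [folklore] -/
theorem cover7a1 : allVecsB (boxBounds 7 (box7 1)) 7 (chk (7 + 1) mask7) = true := by decide +kernel

set_option maxHeartbeats 4000000 in
/-- Kernel enumeration, `d = 7`, box 2 (`17 550` lists). [folklore] -/
theorem cover7a2 : allVecsB (boxBounds 7 (box7 2)) 7 (chk (7 + 1) mask7) = true := by decide +kernel

set_option maxHeartbeats 4000000 in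
/-- Kernel enumeration, `d = 7`, box 3 (`14 950` lists). [folklore] -/
theorem cover7a3 : allVecsB (boxBounds 7 (box7 3)) 7 (chk (7 + 1) mask7) = true := by decide +kernel

set_option maxHeartbeats 4000000 in
/-- Kernel enumeration, `d = 7`, box 4 (`12 650` lists). [folklore] -/
theorem cover7a4 : allVecsB (boxBounds 7 (box7 4)) 7 (chk (7 + 1) mask7) = true := by decide +kernel

set_option maxHeartbeats 4000000 in
/-- Kernel enumeration, `d = 7`, box 5 (`10 626` lists). [folklore] -/
theorem cover7a5 : allVecsB (boxBounds 7 (box7 5)) 7 (chk (7 + 1) mask7) = true := by decide +kernel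

set_option maxHeartbeats 4000000 in
/-- Kernel enumeration, `d = 7`, box 6 (`8 855` lists). [folklore] -/
theorem cover7a6 : allVecsB (boxBounds 7 (box7 6)) 7 (chk (7 + 1) mask7) = true := by decide +kernel

set_option maxHeartbeats 4000000 in
/-- Kernel enumeration, `d = 7`, box 7 (`7 315` lists). [folklore] -/
theorem cover7a7 : allVecsB (boxBounds 7 (box7 7)) 7 (chk (7 + 1) mask7) = true := by decide +kernel

set_option maxHeartbeats 4000000 in
/-- Kernel enumeration, `d = 7`, box 8 (`5 985` lists). [folklore] -/
theorem cover7a8 : allVecsB (boxBounds 7 (box7 8)) 7 (chk (7 + 1) mask7) = true := by decide +kernel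

set_option maxHeartbeats 4000000 in
/-- Kernel enumeration, `d = 7`, box 9 (`20 349` lists). [folklore] -/
theorem cover7a9 : allVecsB (boxBounds 7 (box7 9)) 7 (chk (7 + 1) mask7) = true := by decide +kernel

set_option maxHeartbeats 4000000 in
/-- Kernel enumeration, `d = 7`, normal form (ii). [folklore] -/
theorem cover7b : allVecsB (nfBounds2 7) 7 (chk (7 + 1) mask7) = true := by decide +kernel

/-- Kernel enumeration, `d = 7`, normal form (iii). [folklore] -/
theorem cover7c : allVecsB (nfBounds3 7) 7 (chk (7 + 1) mask7) = true := by decide +kernel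

/-! ## From boxes to normal form (i) -/

/-- Prefix bounds check on an explicit list (structural, so that it computes on `a₀ :: a₁ :: …`). [folklore] -/
def prefixOK : List (ℕ × ℕ) → List ℕ → Bool
  | [], _ => true
  | _ :: _, [] => false
  | b :: pre, a :: l => (b.1 ≤ a && a ≤ b.2) && prefixOK pre l

/-- Semantics of `prefixOK`. [folklore] -/
theorem prefixOK_spec : ∀ (pre : List (ℕ × ℕ)) (l : List ℕ), prefixOK pre l = true →
    ∀ i < pre.length, (pre.getD i (0, 0)).1 ≤ l.getD i 0 ∧ l.getD i 0 ≤ (pre.getD i (0, 0)).2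
  | [], _, _, i, hi => by simp at hi
  | _ :: _, [], h, _, _ => by simp [prefixOK] at h
  | b :: pre, a :: l, h, i, hi => by
    simp only [prefixOK, Bool.and_eq_true, decide_eq_true_eq] at h
    rcases i with _ | i
    · simpa using h.1
    · simp only [List.length_cons, Nat.add_lt_add_iff_right] at hi
      simpa using prefixOK_spec pre l h.2 i hi

/-- The bounds hypothesis of `allVecsB_spec` for a box, from the prefix check and the base bounds. [folklore] -/
theorem boxBounds_spec (d : ℕ) (pre : List (ℕ × ℕ)) (l : List ℕ) (hpre : prefixOK pre l = true)
    (hbase : ∀ i < 25, (if i = 1 ∨ i = 5 then 1 else 0) ≤ l.getD i 0 ∧ l.getD i 0 ≤ d) :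
    ∀ i < (boxBounds d pre).length,
      ((boxBounds d pre).getD i (0, 0)).1 ≤ l.getD i 0 ∧ l.getD i 0 ≤ ((boxBounds d pre).getD i (0, 0)).2 := by
  intro i hi
  have hi25 : i < 25 := by simpa [boxBounds] using hi
  have hget : (boxBounds d pre).getD i (0, 0) = pre.getD i (if i = 1 ∨ i = 5 then 1 else 0, d) := by
    simp [boxBounds, List.getD_eq_getElem?_getD, List.getElem?_range hi25]
  rw [hget]
  by_cases hip : i < pre.length
  · have h := prefixOK_spec pre l hpre i hip
    rwa [List.getD_eq_getElem _ _ hip] at h ⊢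
  · have hnone : pre.getD i ((if i = 1 ∨ i = 5 then 1 else 0), d) = ((if i = 1 ∨ i = 5 then 1 else 0), d) := by
      rw [List.getD_eq_getElem?_getD, List.getElem?_eq_none_iff.mpr (by omega), Option.getD_none]
    rw [hnone]
    exact hbase i hi25

/-- A list of length `≥ 8` starts with eight explicit entries. [folklore] -/
theorem exists_cons8 (l : List ℕ) (hl : 8 ≤ l.length) :
    ∃ a₀ a₁ a₂ a₃ a₄ a₅ a₆ a₇ r, l = a₀ :: a₁ :: a₂ :: a₃ :: a₄ :: a₅ :: a₆ :: a₇ :: r := by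
  rcases l with _ | ⟨a₀, _ | ⟨a₁, _ | ⟨a₂, _ | ⟨a₃, _ | ⟨a₄, _ | ⟨a₅, _ | ⟨a₆, _ | ⟨a₇, r⟩⟩⟩⟩⟩⟩⟩⟩
  iterate 8 simp at hl
  exact ⟨a₀, a₁, a₂, a₃, a₄, a₅, a₆, a₇, r, rfl⟩

/-- **Normal form (i), `d = 7`: the nine boxes cover.**  Every value list of length `25`, sum `7`, with `l[1], l[5] ≥ 1`
passes the check. [folklore] -/
theorem chk_of_nf1_seven (l : List ℕ) (hl : l.length = 25) (hs : l.sum = 7)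
    (hbase : ∀ i < 25, (if i = 1 ∨ i = 5 then 1 else 0) ≤ l.getD i 0 ∧ l.getD i 0 ≤ 7) :
    chk (7 + 1) mask7 l = true := by
  obtain ⟨a₀, a₁, a₂, a₃, a₄, a₅, a₆, a₇, r, rfl⟩ := exists_cons8 l (by omega)
  have h1 : 1 ≤ a₁ := by simpa using (hbase 1 (by omega)).1
  have h5 : 1 ≤ a₅ := by simpa using (hbase 5 (by omega)).1
  simp only [List.sum_cons] at hs
  have go : ∀ n, allVecsB (boxBounds 7 (box7 n)) 7 (chk (7 + 1) mask7) = true →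
      prefixOK (box7 n) (a₀ :: a₁ :: a₂ :: a₃ :: a₄ :: a₅ :: a₆ :: a₇ :: r) = true →
      chk (7 + 1) mask7 (a₀ :: a₁ :: a₂ :: a₃ :: a₄ :: a₅ :: a₆ :: a₇ :: r) = true := fun n hcov hpre =>
    allVecsB_spec _ 7 _ hcov _ (by simp [boxBounds] at hl ⊢; omega) (by simp [List.sum_cons]; omega)
      (boxBounds_spec 7 (box7 n) _ hpre hbase)
  by_cases c0 : 1 ≤ a₀
  · exact go 1 cover7a1 (by simp [prefixOK, box7]; omega)
  by_cases c1 : 2 ≤ a₁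
  · exact go 2 cover7a2 (by simp [prefixOK, box7]; omega)
  by_cases c2 : 1 ≤ a₂
  · exact go 3 cover7a3 (by simp [prefixOK, box7]; omega)
  by_cases c3 : 1 ≤ a₃
  · exact go 4 cover7a4 (by simp [prefixOK, box7]; omega)
  by_cases c4 : 1 ≤ a₄
  · exact go 5 cover7a5 (by simp [prefixOK, box7]; omega)
  by_cases c5 : 2 ≤ a₅
  · exact go 6 cover7a6 (by simp [prefixOK, box7]; omega)
  by_cases c6 : 1 ≤ a₆
  · exact go 7 cover7a7 (by simp [prefixOK, box7]; omega)
  by_cases c7 : 1 ≤ a₇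
  · exact go 8 cover7a8 (by simp [prefixOK, box7]; omega)
  · exact go 9 cover7a9 (by simp [prefixOK, box7]; omega)

/-- **Normal form (i), `d = 6`** (one box). [folklore] -/
theorem chk_of_nf1_six (l : List ℕ) (hl : l.length = 25) (hs : l.sum = 6)
    (hbase : ∀ i < 25, (if i = 1 ∨ i = 5 then 1 else 0) ≤ l.getD i 0 ∧ l.getD i 0 ≤ 6) :
    chk (6 + 1) mask6 l = true :=
  allVecsB_spec _ 6 _ cover6a l (by simp [boxBounds, hl]) hs (boxBounds_spec 6 [] l (by simp [prefixOK]) hbase)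

/-! ## Semantic form -/

/-- Values of `List.ofFn g`. [folklore] -/
theorem getD_ofFn (g : Fin 25 → ℕ) (i : ℕ) (hi : i < 25) : (List.ofFn g).getD i 0 = g ⟨i, hi⟩ := by
  rw [List.getD_eq_getElem _ _ (by simpa using hi), List.getElem_ofFn]

/-- A single value is at most the sum. [folklore] -/
theorem apply_le_sum (g : Fin 25 → ℕ) (i : Fin 25) : g i ≤ ∑ k, g k :=
  Finset.single_le_sum (f := g) (fun _ _ => Nat.zero_le _) (mem_univ i)

/-- **From the kernel enumerations to the semantic statement** (generic in `d`; normal form (i) enters through its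
semantic form `ha`). [folklore] -/
theorem exists_entry_of_covers {d : ℕ} {T : List (List ℕ × List (ℕ × List ℕ))} {mask : ℕ}
    (hmask : ∀ c₀ < d + 1, ∀ c₁ < d + 1, ∀ c₂ < d + 1, ∀ c₃ < d + 1, ∀ c₄ < d + 1,
      mask.testBit (horner5 (d + 1) c₀ c₁ c₂ c₃ c₄) = true → ∃ e ∈ T, e.1 = [c₀, c₁, c₂, c₃, c₄])
    (ha : ∀ l : List ℕ, l.length = 25 → l.sum = d →
      (∀ i < 25, (if i = 1 ∨ i = 5 then 1 else 0) ≤ l.getD i 0 ∧ l.getD i 0 ≤ d) → chk (d + 1) mask l = true)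
    (hb : allVecsB (nfBounds2 d) d (chk (d + 1) mask) = true)
    (hc : allVecsB (nfBounds3 d) d (chk (d + 1) mask) = true)
    (g : Fin 25 → ℕ) (hg : ∑ i, g i = d)
    (hNF : (1 ≤ g 5 ∧ 1 ≤ g 1) ∨ (1 ≤ g 5 ∧ ∀ i : Fin 25, i.val % 5 ≠ 0 → g i = 0) ∨
      (∀ i : Fin 25, i.val ≠ 0 → g i = 0)) :
    ∃ j < 6, ∃ e ∈ T, ∀ v < 5, e.1.getD v 0 = ∑ i : Fin 25, pick v (pv j i.val) (g i) := by
  refine exists_entry_of_chk hmask g hg ?_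
  have hlen : (List.ofFn g).length = 25 := List.length_ofFn
  have hsum : (List.ofFn g).sum = d := by rw [List.sum_ofFn, hg]
  have hle : ∀ i : Fin 25, g i ≤ d := fun i => hg ▸ apply_le_sum g i
  rcases hNF with ⟨h5, h1⟩ | ⟨h5, hax⟩ | h0
  · refine ha (List.ofFn g) hlen hsum fun i hi => ?_
    rw [getD_ofFn g i hi]
    refine ⟨?_, hle _⟩
    split_ifs with h
    · rcases h with rfl | rfl
      · exact h1
      · exact h5
    · exact Nat.zero_le _
  · refine allVecsB_spec _ d _ hb (List.ofFn g) (by simp [nfBounds2]) hsum fun i hi => ?_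
    simp only [nfBounds2, List.length_map, List.length_range] at hi
    rw [getD_ofFn g i hi]
    simp only [nfBounds2, List.getD_eq_getElem?_getD, List.getElem?_map, List.getElem?_range hi, Option.map_some,
      Option.getD_some]
    constructor
    · split_ifs with h
      · subst h; exact h5
      · exact Nat.zero_le _
    · split_ifs with h
      · exact hle _
      · exact le_of_eq (hax ⟨i, hi⟩ h)
  · refine allVecsB_spec _ d _ hc (List.ofFn g) (by simp [nfBounds3]) hsum fun i hi => ?_
    simp only [nfBounds3, List.length_map, List.length_range] at hi
    rw [getD_ofFn g i hi]
    simp only [nfBounds3, List.getD_eq_getElem?_getD, List.getElem?_map, List.getElem?_range hi, Option.map_some,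
      Option.getD_some]
    split_ifs with h
    · subst h
      have : ∑ k, g k = g ⟨0, hi⟩ := by
        rw [← Finset.sum_erase_add _ _ (mem_univ (⟨0, hi⟩ : Fin 25)), Finset.sum_eq_zero fun k hk => ?_]
        · simp
        · exact h0 k (fun e => (Finset.mem_erase.1 hk).1 (Fin.ext e))
      exact ⟨by rw [← hg, this], hle _⟩
    · exact ⟨Nat.zero_le _, le_of_eq (h0 ⟨i, hi⟩ h)⟩

/-- **Every value function of sum `6` in normal form has a certified line projection.** [folklore] -/
theorem exists_table_entry_six (g : Fin 25 → ℕ) (hg : ∑ i, g i = 6)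
    (hNF : (1 ≤ g 5 ∧ 1 ≤ g 1) ∨ (1 ≤ g 5 ∧ ∀ i : Fin 25, i.val % 5 ≠ 0 → g i = 0) ∨
      (∀ i : Fin 25, i.val ≠ 0 → g i = 0)) :
    ∃ j < 6, ∃ e ∈ table6, ∀ v < 5, e.1.getD v 0 = ∑ i : Fin 25, pick v (pv j i.val) (g i) :=
  exists_entry_of_covers (d := 6) mask6_sound chk_of_nf1_six cover6b cover6c g hg hNF

/-- **Every value function of sum `7` in normal form has a certified line projection.** [folklore] -/
theorem exists_table_entry_seven (g : Fin 25 → ℕ) (hg : ∑ i, g i = 7)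
    (hNF : (1 ≤ g 5 ∧ 1 ≤ g 1) ∨ (1 ≤ g 5 ∧ ∀ i : Fin 25, i.val % 5 ≠ 0 → g i = 0) ∨
      (∀ i : Fin 25, i.val ≠ 0 → g i = 0)) :
    ∃ j < 6, ∃ e ∈ table7, ∀ v < 5, e.1.getD v 0 = ∑ i : Fin 25, pick v (pv j i.val) (g i) :=
  exists_entry_of_covers (d := 7) mask7_sound chk_of_nf1_seven cover7b cover7c g hg hNF

end Z5Z5Domino

end Summit.MatrixMultiplication.OmegaCensus
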